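import Literature.NumberTheory.Automorphic.UnitaryGroupLineUnipotentTwo
import Literature.NumberTheory.Automorphic.UnitaryGroupSingularTorusNormalForm
import HarnessLib

/-!
# Haar normalisation on `N(𝔸_F) ≅ 𝔸_E⁻` of `U(J₂)`: the `ν`-average over `N(𝔸_F)` is the line average
# `(μY(𝓕⁻)) · ν(𝓕)⁻¹ · ∫_{N(𝔸_F)} g dν = ∫_{𝔸_E⁻} g(n(b)) dμY(b)`
(Rogawski, *Automorphic Representations of Unitary Groups in Three Variables* (1990), Prop. 7.3.1 p. 98 (`G = U(2)`): the
unipotent term is a Tate integral along the line `N = {n(b) : b + b̄ = 0}`; Cassels–Fröhlich, Ch. XV (Tate), Thm. 4.1.3 for the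
covolume of `E⁻ ⊂ 𝔸_E⁻`.)

Topic `NumberTheory/Automorphic`; namespace `Literature.NumberTheory.Automorphic.UnitaryGroup`. THEOREMS ONLY over accepted tree
modules (no definition, no named fact, no instance, no notation, no `sorry`). The `N = 2` twin (ET-ν)_two of ★
`UnitaryGroupUnipotentHaarNormalisation` §2–§3 (H-side copy of the LAW trunk of `Cruxes/H413/Lines/F0_T1InnerFormTraceIdentity.lean` for
`H = U(Φ₂) × U(Φ₁)`; cell hodgecm-mathlib, crux H413; CENSUS-LAWS-Hside §3 (σ-u); dealt by the (σ-u) head owner A-p17 (g17)), with the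
Heisenberg chart `heisChart (μX ⊗ μY)` REPLACED by the LINE chart `n(b) := middleRootUnipotent hij hN (ofAdd b)` of ★ H-B1a
`UnitaryGroupLineUnipotentTwo` (B-p04 (g28): `isHaarMeasure_map_middleRootUnipotent_two`, `eq_haarScalarFactor_smul_map_middleRootUnipotent_two`,
`map_middleRootUnipotent_apply_two`, `isFundamentalDomain_image_traceZeroFundamentalDomain_two`, `integral_map_middleRootUnipotent_two`).
Letters: `hij : (0 : Fin 2) + 1 = 1`, `hN : 2 = 2·0 + 2` (the root-position binders of ★ `middleRootUnipotent`), an additive Haar measure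
`μY` on `𝔸_E⁻ = traceZeroAdele F E c`, ANY Haar measure `ν` on `adelicUnipotent F E c 2`, ANY fundamental domain `𝓕` of
`rationalUnipotent F E c 2`, `𝓕⁻ = traceZeroFundamentalDomain F E c`.

* §1 `measure_map_line_image_traceZeroFundamentalDomain_two` (`(n_* μY)(n 𝓕⁻) = μY 𝓕⁻`), `measure_traceZeroFundamentalDomain_ne_zero_and_lt_top`
  (`0 < μY(𝓕⁻) < ∞`), `exists_eq_smul_map_line_two` (`ν = r • n_* μY`, `r > 0`), **`measure_fundamentalDomain_eq_two`**
  (`ν 𝓕 = r · μY(𝓕⁻)`), `measure_fundamentalDomain_ne_zero_and_lt_top_two`.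
* §2 `lintegral_mul_eq_measure_mul_lintegral_line_two`, `integrable_comp_line_iff_two`, `smul_integral_eq_measure_smul_integral_line_two`,
  **`mul_inv_mul_integral_eq_integral_line_two`**: `(μY(𝓕⁻) : ℂ) · (ν 𝓕)⁻¹ · ∫ g dν = ∫_{𝔸_E⁻} g(n b) dμY` (integrable `g`).
* §3 THE `𝔸_F`-READING at `μY := θ_* μA` (`θ =` ★ `traceZeroLine`, ★ `map_traceZeroLine_traceZeroFundamentalDomain`):
  **`inv_mul_integral_eq_inv_mul_integral_traceZeroLine_two`**: `(ν 𝓕)⁻¹ · ∫ g dν = μA(D_F)⁻¹ · ∫_{𝔸_F} g(n(θ x)) dμA(x)`.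

## References
* J. D. Rogawski, *Automorphic Representations of Unitary Groups in Three Variables*, Ann. of Math. Stud. 123 (1990), Prop. 7.3.1
  (p. 98), §7.3 (p. 97) [Rogawski1990].
* J. W. S. Cassels, A. Fröhlich (eds.), *Algebraic Number Theory* (1967), Ch. XV (Tate), Thm. 4.1.3 [CasselsFrohlichANT1967].
* J. R. Getz, H. Hahn, *An Introduction to Automorphic Representations*, GTM 300 (2024), §3.5 [GetzHahn2024].
-/

set_option autoImplicit false

noncomputable section

open MeasureTheory Measure NumberField IsDedekindDomain Set
open scoped NNReal ENNReal MatrixGroups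

namespace Literature.NumberTheory.Automorphic

namespace UnitaryGroup

variable {F E : Type} [Field F] [NumberField F] [Field E] [NumberField E] [Algebra F E]
  {c : E ≃ₐ[F] E}
  (hij : (((0 : Fin 2) : Fin 2) : ℕ) + 1 = (((1 : Fin 2) : Fin 2) : ℕ)) (hN : 2 = 2 * (((0 : Fin 2) : Fin 2) : ℕ) + 2)

section Normalisation

variable [LocallyCompactSpace (AdeleRing (𝓞 E) E)]
  [MeasurableSpace (AdeleRing (𝓞 E) E)] [BorelSpace (AdeleRing (𝓞 E) E)]
  [MeasurableSpace (adelicUnipotent F E c 2)] [BorelSpace (adelicUnipotent F E c 2)]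

/-! ## §1 The transported measure, Haar uniqueness, the mass of a fundamental domain -/

omit [LocallyCompactSpace (AdeleRing (𝓞 E) E)] in
/-- **`(n_* μY)(n 𝓕⁻) = μY(𝓕⁻)`** (the chart is injective, ★ `middleRootUnipotent_two_injective`, and ★
`map_middleRootUnipotent_apply_two`). [cite: CasselsFrohlichANT1967, Ch. XV Thm. 4.1.3 (2)] -/
theorem measure_map_line_image_traceZeroFundamentalDomain_two (μY : Measure (traceZeroAdele F E c)) :
    (μY.map fun b : traceZeroAdele F E c => middleRootUnipotent hij hN (Multiplicative.ofAdd b))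
        ((fun b : traceZeroAdele F E c => middleRootUnipotent hij hN (Multiplicative.ofAdd b)) ''
          traceZeroFundamentalDomain F E c) =
      μY (traceZeroFundamentalDomain F E c) := by
  rw [map_middleRootUnipotent_apply_two hij hN μY,
    (middleRootUnipotent_two_injective (F := F) (E := E) (c := c) hij hN).preimage_image]

omit [NumberField F] [LocallyCompactSpace (AdeleRing (𝓞 E) E)] [MeasurableSpace (adelicUnipotent F E c 2)]
  [BorelSpace (adelicUnipotent F E c 2)] in
/-- **`0 < μY(𝓕⁻) < ∞`**: `𝓕⁻` is a fundamental domain of the countable lattice `E⁻` (positive mass, ★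
`isAddFundamentalDomain_traceZeroFundamentalDomain`) inside a compact set (finite mass, ★ `measure_traceZeroFundamentalDomain_lt_top`).
[cite: CasselsFrohlichANT1967, Ch. XV Thm. 4.1.3] -/
theorem measure_traceZeroFundamentalDomain_ne_zero_and_lt_top (hc : c * c = 1)
    (μY : Measure (traceZeroAdele F E c)) [μY.IsAddHaarMeasure] :
    μY (traceZeroFundamentalDomain F E c) ≠ 0 ∧ μY (traceZeroFundamentalDomain F E c) < ⊤ := by
  haveI : Countable (rationalTraceZero F E c) := countable_rationalTraceZero
  exact ⟨(isAddFundamentalDomain_traceZeroFundamentalDomain hc μY).measure_ne_zero (NeZero.ne μY),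
    measure_traceZeroFundamentalDomain_lt_top hc μY⟩

/-- **Haar uniqueness on `N(𝔸_F)` of `U(J₂)`**: every Haar measure `ν` on `adelicUnipotent F E c 2` is `r • n_* μY` for some `r > 0`
(★ `eq_haarScalarFactor_smul_map_middleRootUnipotent_two`, Mathlib `haarScalarFactor_pos_of_isHaarMeasure`); the twin of ★
`exists_eq_smul_map_prod_heisChart`. [cite: Rogawski1990, §1.10] -/
theorem exists_eq_smul_map_line_two (μY : Measure (traceZeroAdele F E c)) [μY.IsAddHaarMeasure]
    (ν : Measure (adelicUnipotent F E c 2)) [ν.IsHaarMeasure] :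
    ∃ r : ℝ≥0, 0 < r ∧ ν = (r : ℝ≥0∞) • μY.map (fun b : traceZeroAdele F E c => middleRootUnipotent hij hN (Multiplicative.ofAdd b)) := by
  haveI := isHaarMeasure_map_middleRootUnipotent_two (F := F) (E := E) (c := c) hij hN μY
  refine ⟨ν.haarScalarFactor (μY.map fun b : traceZeroAdele F E c => middleRootUnipotent hij hN (Multiplicative.ofAdd b)),
    haarScalarFactor_pos_of_isHaarMeasure _ _, ?_⟩
  refine (eq_haarScalarFactor_smul_map_middleRootUnipotent_two hij hN ν μY).trans ?_
  ext s hs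
  simp only [Measure.smul_apply, ENNReal.smul_def, smul_eq_mul]

omit [LocallyCompactSpace (AdeleRing (𝓞 E) E)] in
/-- **The mass of a fundamental domain.** For every Haar measure `ν = r • n_* μY` on `N(𝔸_F)` and every fundamental domain `𝓕` of
`N(F)` for `ν`: `ν(𝓕) = r · μY(𝓕⁻)` (two fundamental domains have the same mass, Mathlib `IsFundamentalDomain.measure_eq`, against
★ `isFundamentalDomain_image_traceZeroFundamentalDomain_two`); the twin of ★ `measure_fundamentalDomain_eq`. [cite: Rogawski1990, §2.1]
[cite: CasselsFrohlichANT1967, Ch. XV Thm. 4.1.3] -/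
theorem measure_fundamentalDomain_eq_two (hc : c * c = 1) (μY : Measure (traceZeroAdele F E c))
    (ν : Measure (adelicUnipotent F E c 2)) [ν.IsHaarMeasure] {r : ℝ≥0}
    (hr : ν = (r : ℝ≥0∞) • μY.map (fun b : traceZeroAdele F E c => middleRootUnipotent hij hN (Multiplicative.ofAdd b)))
    {𝓕 : Set (adelicUnipotent F E c 2)} (h𝓕 : IsFundamentalDomain (rationalUnipotent F E c 2) 𝓕 ν) :
    ν 𝓕 = r * μY (traceZeroFundamentalDomain F E c) := by
  haveI : MeasurableConstSMul (rationalUnipotent F E c 2) (adelicUnipotent F E c 2) :=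
    ⟨fun γ => (continuous_const.mul continuous_id).measurable⟩
  haveI : SMulInvariantMeasure (rationalUnipotent F E c 2) (adelicUnipotent F E c 2) ν :=
    ⟨fun γ s _hs => by
      rw [show (fun u : adelicUnipotent F E c 2 => γ • u) ⁻¹' s =
          (fun u : adelicUnipotent F E c 2 => ((γ : adelicUnipotent F E c 2)) * u) ⁻¹' s from rfl,
        measure_preimage_mul]⟩
  haveI : Countable (rationalUnipotent F E c 2) := by
    haveI : Countable (quasiSplit F E c 2).arithmeticSubgroup := by
      haveI : Countable E := NumberField.countable' (K := E)
      haveI : Countable (Matrix (Fin 2) (Fin 2) E) := inferInstanceAs (Countable (Fin 2 → Fin 2 → E))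
      haveI : Countable (GL (Fin 2) E) := Units.val_injective.countable
      haveI : Countable (quasiSplit F E c 2).Rational :=
        inferInstanceAs (Countable (rational F E c 2 ((StdForm.antidiagonal 2).over E)))
      exact (Set.countable_range _).to_subtype
    have h1 : Function.Injective fun γ : rationalUnipotent F E c 2 =>
        (⟨((γ : adelicUnipotent F E c 2) : (quasiSplit F E c 2).Adelic), γ.2⟩ :
          (quasiSplit F E c 2).arithmeticSubgroup) := fun a a' h =>
      Subtype.ext (Subtype.ext (congrArg
        (fun z : (quasiSplit F E c 2).arithmeticSubgroup => (z : (quasiSplit F E c 2).Adelic)) h))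
    exact h1.countable
  rw [h𝓕.measure_eq (isFundamentalDomain_image_traceZeroFundamentalDomain_two (F := F) (E := E) (c := c) hij hN hc ν), hr,
    Measure.smul_apply, measure_map_line_image_traceZeroFundamentalDomain_two hij hN μY, smul_eq_mul]

include hij hN in
/-- `ν(𝓕) ≠ 0` and `ν(𝓕) < ∞` for a fundamental domain `𝓕` of `N(F)` and a Haar measure `ν` of `N(𝔸_F)` (`U(J₂)`); the twin of ★
`measure_fundamentalDomain_ne_zero_and_lt_top` (read off any additive Haar measure `μY` of `𝔸_E⁻`). [cite: Rogawski1990, §2.1] -/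
theorem measure_fundamentalDomain_ne_zero_and_lt_top_two (hc : c * c = 1) (μY : Measure (traceZeroAdele F E c))
    [μY.IsAddHaarMeasure] (ν : Measure (adelicUnipotent F E c 2)) [ν.IsHaarMeasure]
    {𝓕 : Set (adelicUnipotent F E c 2)} (h𝓕 : IsFundamentalDomain (rationalUnipotent F E c 2) 𝓕 ν) :
    ν 𝓕 ≠ 0 ∧ ν 𝓕 < ⊤ := by
  obtain ⟨r, hr, hν⟩ := exists_eq_smul_map_line_two hij hN μY ν
  obtain ⟨h0, ht⟩ := measure_traceZeroFundamentalDomain_ne_zero_and_lt_top (F := F) (E := E) (c := c) hc μY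
  rw [measure_fundamentalDomain_eq_two hij hN hc μY ν hν h𝓕]
  exact ⟨mul_ne_zero (ENNReal.coe_ne_zero.2 hr.ne') h0, ENNReal.mul_lt_top ENNReal.coe_lt_top ht⟩

/-! ## §2 The heads: `ν`-averages versus line averages -/

/-- **Lebesgue form**: `μY(𝓕⁻) · ∫⁻ g dν = ν(𝓕) · ∫⁻_{𝔸_E⁻} g(n b) dμY` for measurable `g ≥ 0`. [cite: Rogawski1990, Prop. 7.3.1 (p. 98)] -/
theorem lintegral_mul_eq_measure_mul_lintegral_line_two (hc : c * c = 1) (μY : Measure (traceZeroAdele F E c))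
    [μY.IsAddHaarMeasure] (ν : Measure (adelicUnipotent F E c 2)) [ν.IsHaarMeasure]
    {𝓕 : Set (adelicUnipotent F E c 2)} (h𝓕 : IsFundamentalDomain (rationalUnipotent F E c 2) 𝓕 ν)
    (g : adelicUnipotent F E c 2 → ℝ≥0∞) :
    μY (traceZeroFundamentalDomain F E c) * ∫⁻ m, g m ∂ν =
      ν 𝓕 * ∫⁻ b, g (middleRootUnipotent hij hN (Multiplicative.ofAdd b)) ∂μY := by
  obtain ⟨r, hr, hν⟩ := exists_eq_smul_map_line_two hij hN μY ν
  rw [measure_fundamentalDomain_eq_two hij hN hc μY ν hν h𝓕]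
  conv_lhs => rw [hν]
  rw [lintegral_smul_measure, lintegral_map_middleRootUnipotent_two hij hN μY]
  simp only [smul_eq_mul]
  ring

/-- **Integrability along the chart**: `g` is `ν`-integrable iff `b ↦ g(n b)` is `μY`-integrable. [cite: Rogawski1990, Prop. 7.3.1 (p. 98)] -/
theorem integrable_comp_line_iff_two (μY : Measure (traceZeroAdele F E c)) [μY.IsAddHaarMeasure]
    (ν : Measure (adelicUnipotent F E c 2)) [ν.IsHaarMeasure]
    {V : Type*} [NormedAddCommGroup V] (g : adelicUnipotent F E c 2 → V) :
    Integrable (fun b : traceZeroAdele F E c => g (middleRootUnipotent hij hN (Multiplicative.ofAdd b))) μY ↔ Integrable g ν := by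
  obtain ⟨r, hr, hν⟩ := exists_eq_smul_map_line_two hij hN μY ν
  rw [hν, integrable_smul_measure (ENNReal.coe_ne_zero.2 hr.ne') ENNReal.coe_ne_top,
    (measurableEmbedding_middleRootUnipotent_two hij hN).integrable_map_iff]
  rfl

/-- **Bochner form**: `(μY 𝓕⁻).toReal • ∫ g dν = (ν 𝓕).toReal • ∫_{𝔸_E⁻} g(n b) dμY` for `ν`-integrable `g`. [cite: Rogawski1990, Prop. 7.3.1 (p. 98)] -/
theorem smul_integral_eq_measure_smul_integral_line_two (hc : c * c = 1) (μY : Measure (traceZeroAdele F E c))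
    [μY.IsAddHaarMeasure] (ν : Measure (adelicUnipotent F E c 2)) [ν.IsHaarMeasure]
    {𝓕 : Set (adelicUnipotent F E c 2)} (h𝓕 : IsFundamentalDomain (rationalUnipotent F E c 2) 𝓕 ν)
    {V : Type*} [NormedAddCommGroup V] [NormedSpace ℝ V] (g : adelicUnipotent F E c 2 → V) :
    (μY (traceZeroFundamentalDomain F E c)).toReal • ∫ m, g m ∂ν =
      (ν 𝓕).toReal • ∫ b, g (middleRootUnipotent hij hN (Multiplicative.ofAdd b)) ∂μY := by
  obtain ⟨r, hr, hν⟩ := exists_eq_smul_map_line_two hij hN μY ν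
  rw [measure_fundamentalDomain_eq_two hij hN hc μY ν hν h𝓕]
  conv_lhs => rw [hν]
  rw [integral_smul_measure, integral_map_middleRootUnipotent_two hij hN μY, smul_smul]
  congr 1
  simp only [ENNReal.toReal_mul, ENNReal.coe_toReal]
  ring

/-- **Normalised form** (the (ET-ν)_two letter of the `U(2)` central term): for `ℂ`-valued `g`,
`(μY 𝓕⁻ : ℂ) · (ν 𝓕)⁻¹ · ∫ g dν = ∫_{𝔸_E⁻} g(n b) dμY` — the normalised unipotent average of the kernel letters (`(ν 𝓕)⁻¹ ∫_N`, any
Haar `ν`, any fundamental domain `𝓕`) is the line integral divided by the line covolume `μY(𝓕⁻)`; the twin of ★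
`mul_inv_mul_integral_eq_integral_heisChart`. [cite: Rogawski1990, Prop. 7.3.1 (p. 98)] -/
theorem mul_inv_mul_integral_eq_integral_line_two (hc : c * c = 1) (μY : Measure (traceZeroAdele F E c))
    [μY.IsAddHaarMeasure] (ν : Measure (adelicUnipotent F E c 2)) [ν.IsHaarMeasure]
    {𝓕 : Set (adelicUnipotent F E c 2)} (h𝓕 : IsFundamentalDomain (rationalUnipotent F E c 2) 𝓕 ν)
    (g : adelicUnipotent F E c 2 → ℂ) :
    (((μY (traceZeroFundamentalDomain F E c)).toReal : ℝ) : ℂ) * ((((ν 𝓕).toReal⁻¹ : ℝ)) : ℂ) * ∫ m, g m ∂ν =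
      ∫ b, g (middleRootUnipotent hij hN (Multiplicative.ofAdd b)) ∂μY := by
  have h := smul_integral_eq_measure_smul_integral_line_two hij hN hc μY ν h𝓕 g
  obtain ⟨h0', ht'⟩ := measure_fundamentalDomain_ne_zero_and_lt_top_two hij hN hc μY ν h𝓕
  have h0 : (ν 𝓕).toReal ≠ 0 := ENNReal.toReal_ne_zero.2 ⟨h0', ht'.ne⟩
  rw [Complex.real_smul, Complex.real_smul] at h
  rw [mul_comm _ ((((ν 𝓕).toReal⁻¹ : ℝ)) : ℂ), mul_assoc, h, ← mul_assoc, ← Complex.ofReal_mul, inv_mul_cancel₀ h0,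
    Complex.ofReal_one, one_mul]

end Normalisation

/-! ## §3 The `𝔸_F`-reading along `θ : 𝔸_F ≃ 𝔸_E⁻` -/

section TraceZeroLine

variable [Algebra.IsQuadraticExtension F E] {δ : E} (hcδ : c δ = -δ) (hδ : δ ≠ 0)
  [LocallyCompactSpace (AdeleRing (𝓞 E) E)]
  [MeasurableSpace (AdeleRing (𝓞 E) E)] [BorelSpace (AdeleRing (𝓞 E) E)]
  [MeasurableSpace (AdeleRing (𝓞 F) F)] [BorelSpace (AdeleRing (𝓞 F) F)]
  [MeasurableSpace (adelicUnipotent F E c 2)] [BorelSpace (adelicUnipotent F E c 2)]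

/-- **THE `𝔸_F`-READING**: for every additive Haar measure `μA` of `𝔸_F`, every Haar measure `ν` of `N(𝔸_F)` (`U(J₂)`), every fundamental
domain `𝓕` of `N(F)` and every `ℂ`-valued `g`:
`(ν 𝓕)⁻¹ · ∫_{N(𝔸_F)} g dν = μA(D_F)⁻¹ · ∫_{𝔸_F} g(n(θ x)) dμA(x)` — §2 at `μY := θ_* μA` (a Haar measure of `𝔸_E⁻`), with
`(θ_* μA)(𝓕⁻) = μA(D_F)` (★ `map_traceZeroLine_traceZeroFundamentalDomain`) — so the covolume normalisation of the kernel letters meets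
Tate's `μA(D_F)⁻¹` ON THE NOSE. [cite: Rogawski1990, Prop. 7.3.1 (p. 98)] [cite: CasselsFrohlichANT1967, Ch. XV Thm. 4.1.3 (2)] -/
theorem inv_mul_integral_eq_inv_mul_integral_traceZeroLine_two (hc : c * c = 1)
    (μA : Measure (AdeleRing (𝓞 F) F)) [μA.IsAddHaarMeasure]
    (ν : Measure (adelicUnipotent F E c 2)) [ν.IsHaarMeasure]
    {𝓕 : Set (adelicUnipotent F E c 2)} (h𝓕 : IsFundamentalDomain (rationalUnipotent F E c 2) 𝓕 ν)
    (g : adelicUnipotent F E c 2 → ℂ) :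
    ((((ν 𝓕).toReal⁻¹ : ℝ)) : ℂ) * ∫ m, g m ∂ν =
      ((((μA (adeleFundamentalDomain F)).toReal⁻¹ : ℝ)) : ℂ) *
        ∫ x, g (middleRootUnipotent hij hN (Multiplicative.ofAdd (traceZeroLine F E c hcδ hδ x))) ∂μA := by
  set θ : AdeleRing (𝓞 F) F → traceZeroAdele F E c := fun x => traceZeroLine F E c hcδ hδ x with hθ
  haveI : (μA.map θ).IsAddHaarMeasure := (traceZeroLine F E c hcδ hδ).isAddHaarMeasure_map μA
  have hD : μA.map θ (traceZeroFundamentalDomain F E c) = μA (adeleFundamentalDomain F) :=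
    map_traceZeroLine_traceZeroFundamentalDomain E c hcδ hδ hc μA
  have hme : MeasurableEmbedding θ := (traceZeroLine F E c hcδ hδ).toHomeomorph.measurableEmbedding
  have h := mul_inv_mul_integral_eq_integral_line_two hij hN hc (μA.map θ) ν h𝓕 g
  rw [hD, hme.integral_map] at h
  obtain ⟨hD0, hDt⟩ := measure_traceZeroFundamentalDomain_ne_zero_and_lt_top (F := F) (E := E) (c := c) hc (μA.map θ)
  rw [hD] at hD0 hDt
  have hDr : (μA (adeleFundamentalDomain F)).toReal ≠ 0 := ENNReal.toReal_ne_zero.2 ⟨hD0, hDt.ne⟩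
  -- divide §2's identity by `μA(D_F)`
  have h' : ((((μA (adeleFundamentalDomain F)).toReal⁻¹ : ℝ)) : ℂ) *
      ((((μA (adeleFundamentalDomain F)).toReal : ℝ) : ℂ) * ((((ν 𝓕).toReal⁻¹ : ℝ)) : ℂ) * ∫ m, g m ∂ν) =
      ((((μA (adeleFundamentalDomain F)).toReal⁻¹ : ℝ)) : ℂ) * ∫ x, g (middleRootUnipotent hij hN (Multiplicative.ofAdd (θ x))) ∂μA :=
    congrArg (fun z : ℂ => ((((μA (adeleFundamentalDomain F)).toReal⁻¹ : ℝ)) : ℂ) * z) h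
  rw [← mul_assoc, ← mul_assoc, ← Complex.ofReal_mul, inv_mul_cancel₀ hDr, Complex.ofReal_one, one_mul] at h'
  rw [h']

end TraceZeroLine

end UnitaryGroup

end Literature.NumberTheory.Automorphic

end
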